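import Summits.QuantumFields.QCD.Theorems.SpectralDefectExtinctionWindowExtinctionChessboardDefs

/-!
# Crux `WindowExtinction` (stmt-QuantumFields-8964), line `chessboard-cold-cells`:
# the chessboard estimate on an ODD cycle from the reflection Schwarz inequality

Support file for stub (S1) `stub_chessboard` (time-column chessboard on odd tori).  Purely
combinatorial part: on the cycle `ℤ/(2S+1)`, `S ≥ 1`, a non-negative, rotation-invariant functional
`Φ` of assignments `σ : ℤ/(2S+1) → ι` obeying the reflection Schwarz inequality
`Φ(σ)² ≤ Φ(σ⁺) Φ(σ⁻)` for the reflection `t ↦ 1 - t` (which fixes the edge midpoint `1/2` and the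
antipodal VERTEX `S + 1`; `σ⁺ = plusHalf σ` keeps the closed half `1 ≤ t ≤ S + 1` and reflects it,
`σ⁻ = minusHalf σ` keeps the complementary closed half) satisfies the chessboard estimate
`Φ(σ)^{2S+1} ≤ ∏_t Φ(const (σ t))` (`OddCycle.chessboard`, anchored as `oddCycle_chessboard`).

Proof: the Fröhlich–Israel–Lieb–Simon maximisation argument (CMP 62 (1978), proof of Thm 2.2),
which — unlike the `2ⁿ`-fold iterated Schwarz inequality — works verbatim on odd cycles: the ratio
`Φ(σ ∘ ρ)^N / ∏_t w(ρ t)` over the finitely many re-indexings `ρ` has a maximiser; maximality is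
stable under `ρ ↦ ρ⁺` (Schwarz) and under rotations; and the run-doubling walk
`ρ ↦ rot_{-ℓ}(ρ⁺)` reaches a constant re-indexing, where the ratio is `1` (`OddCycle.walk`).
Positivity of the weights `w` is propagated from `Φ(σ) > 0` by the same walk.
-/

noncomputable section

namespace Summit.QuantumFields.QCD.Cruxes.WindowExtinction.ChessboardColdCells

open MeasureTheory
open scoped ENNReal BigOperators ComplexConjugate ComplexOrder
open Literature.MathematicalPhysics.QuantumLattice Literature.MathematicalPhysics.QuantumFieldTheory
  Literature.Probability.LatticeModels

/-! ## §A  The chessboard estimate on an odd cycle from the reflection Schwarz inequality -/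

namespace OddCycle

variable {S : ℕ} {ι : Type*}

/-- The closed positive half `1 ≤ t ≤ S + 1` of the cycle `ℤ/(2S+1)` (the open half `1 ≤ t ≤ S`
together with the vertex `S + 1` fixed by the reflection `t ↦ 1 - t`), as a `Finset`. -/
def cPlus (S : ℕ) : Finset (ZMod (2 * S + 1)) :=
  Finset.univ.filter fun t => t.val ≠ 0 ∧ t.val ≤ S + 1

/-- The open positive half `1 ≤ t ≤ S` of the cycle `ℤ/(2S+1)`, as a `Finset`. -/
def cMinus (S : ℕ) : Finset (ZMod (2 * S + 1)) :=
  Finset.univ.filter fun t => t.val ≠ 0 ∧ t.val ≤ S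

/-- Membership in the closed positive half. -/
theorem mem_cPlus {t : ZMod (2 * S + 1)} : t ∈ cPlus S ↔ t.val ≠ 0 ∧ t.val ≤ S + 1 := by
  simp [cPlus]

/-- Membership in the open positive half. -/
theorem mem_cMinus {t : ZMod (2 * S + 1)} : t ∈ cMinus S ↔ t.val ≠ 0 ∧ t.val ≤ S := by
  simp [cMinus]

/-- Keep the closed positive half of an assignment and reflect it (`t ↦ 1 - t`) onto the rest. -/
def plusHalf (σ : ZMod (2 * S + 1) → ι) : ZMod (2 * S + 1) → ι :=
  fun t => if t ∈ cPlus S then σ t else σ (1 - t)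

/-- Keep the closed negative half of an assignment and reflect it onto the open positive half. -/
def minusHalf (σ : ZMod (2 * S + 1) → ι) : ZMod (2 * S + 1) → ι :=
  fun t => if t ∈ cMinus S then σ (1 - t) else σ t

/-- Master formula for the value of a difference of two small naturals in `ℤ/(2S+1)`. -/
theorem val_natCast_sub_natCast {a b : ℕ} (ha : a < 2 * S + 1) (hb : b < 2 * S + 1) :
    ((a : ZMod (2 * S + 1)) - (b : ZMod (2 * S + 1))).val =
      if b ≤ a then a - b else a + (2 * S + 1) - b := by
  split_ifs with h
  · rw [← Nat.cast_sub h, ZMod.val_cast_of_lt (by omega)]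
  · have : (a : ZMod (2 * S + 1)) - (b : ZMod (2 * S + 1)) = ((a + (2 * S + 1) - b : ℕ) : ZMod _) := by
      rw [sub_eq_iff_eq_add, ← Nat.cast_add, Nat.sub_add_cancel (by omega), Nat.cast_add,
        ZMod.natCast_self, add_zero]
    rw [this, ZMod.val_cast_of_lt (by omega)]

/-- The value of `1 - t` in `ℤ/(2S+1)`, `S ≥ 1`. -/
theorem val_one_sub (hS : 1 ≤ S) (t : ZMod (2 * S + 1)) :
    (1 - t).val = if t.val ≤ 1 then 1 - t.val else 1 + (2 * S + 1) - t.val := by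
  have : (1 : ZMod (2 * S + 1)) - t = ((1 : ℕ) : ZMod _) - (t.val : ZMod _) := by
    rw [ZMod.natCast_zmod_val, Nat.cast_one]
  rw [this]
  exact val_natCast_sub_natCast (by omega) (ZMod.val_lt t)

/-- The value of `t - ℓ` in `ℤ/(2S+1)` for a small natural `ℓ`. -/
theorem val_sub_natCast {ℓ : ℕ} (hℓ : ℓ < 2 * S + 1) (t : ZMod (2 * S + 1)) :
    (t - (ℓ : ZMod (2 * S + 1))).val = if ℓ ≤ t.val then t.val - ℓ else t.val + (2 * S + 1) - ℓ := by
  conv_lhs => rw [← ZMod.natCast_zmod_val t]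
  exact val_natCast_sub_natCast (ZMod.val_lt t) hℓ

/-- The value of `1 - (t - ℓ) = (1 + ℓ) - t` in `ℤ/(2S+1)` for `1 + ℓ < 2S+1`. -/
theorem val_one_sub_sub_natCast {ℓ : ℕ} (hℓ : 1 + ℓ < 2 * S + 1) (t : ZMod (2 * S + 1)) :
    (1 - (t - (ℓ : ZMod (2 * S + 1)))).val =
      if t.val ≤ 1 + ℓ then 1 + ℓ - t.val else 1 + ℓ + (2 * S + 1) - t.val := by
  have : (1 : ZMod (2 * S + 1)) - (t - (ℓ : ZMod (2 * S + 1))) = ((1 + ℓ : ℕ) : ZMod _) - (t.val : ZMod _) := by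
    rw [ZMod.natCast_zmod_val, Nat.cast_add, Nat.cast_one]; ring
  rw [this]
  exact val_natCast_sub_natCast hℓ (ZMod.val_lt t)

/-- The open half lies in the closed half. -/
theorem cPlus_of_cMinus {t : ZMod (2 * S + 1)} (h : t ∈ cMinus S) : t ∈ cPlus S :=
  mem_cPlus.2 ⟨(mem_cMinus.1 h).1, (mem_cMinus.1 h).2.trans (Nat.le_succ S)⟩

/-- The reflection fixes the vertex `S + 1`. -/
theorem one_sub_eq_self (hS : 1 ≤ S) {t : ZMod (2 * S + 1)} (hp : t ∈ cPlus S) (hm : t ∉ cMinus S) :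
    1 - t = t := by
  have hv : t.val = S + 1 := by
    rw [mem_cPlus] at hp; rw [mem_cMinus] at hm; omega
  apply ZMod.val_injective
  rw [val_one_sub hS, hv, if_neg (by omega)]
  omega

/-- A run `τ = k` on `1 ≤ t ≤ ℓ` with `ℓ ≥ S + 1` makes `plusHalf τ` constant. -/
theorem plusHalf_eq_const_of_run (hS : 1 ≤ S) {τ : ZMod (2 * S + 1) → ι} {k : ι} {ℓ : ℕ}
    (hrun : ∀ t : ZMod (2 * S + 1), t.val ≠ 0 → t.val ≤ ℓ → τ t = k) (hℓ : S + 1 ≤ ℓ) :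
    plusHalf τ = fun _ => k := by
  funext t
  unfold plusHalf
  split_ifs with h
  · exact hrun t (mem_cPlus.1 h).1 ((mem_cPlus.1 h).2.trans hℓ)
  · have hv := val_one_sub hS t
    have ht := ZMod.val_lt t
    rw [mem_cPlus] at h
    refine hrun _ ?_ ?_
    · split_ifs at hv with h1 <;> omega
    · split_ifs at hv with h1 <;> omega

/-- Run doubling: a run `τ = k` on `1 ≤ t ≤ ℓ`, `ℓ ≤ S`, becomes the run `1 ≤ t ≤ 2ℓ` of the
rotate `t ↦ plusHalf τ (t - ℓ)`. -/
theorem plusHalf_sub_of_run (hS : 1 ≤ S) {τ : ZMod (2 * S + 1) → ι} {k : ι} {ℓ : ℕ}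
    (hrun : ∀ t : ZMod (2 * S + 1), t.val ≠ 0 → t.val ≤ ℓ → τ t = k) (hℓ1 : 1 ≤ ℓ) (hℓS : ℓ ≤ S)
    (t : ZMod (2 * S + 1)) (ht0 : t.val ≠ 0) (ht : t.val ≤ 2 * ℓ) :
    plusHalf τ (t - (ℓ : ZMod (2 * S + 1))) = k := by
  have hv := val_sub_natCast (show ℓ < 2 * S + 1 by omega) t
  have hv' := val_one_sub_sub_natCast (show 1 + ℓ < 2 * S + 1 by omega) t
  have htl := ZMod.val_lt t
  unfold plusHalf
  split_ifs with h
  · rw [mem_cPlus] at h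
    refine hrun _ h.1 ?_
    split_ifs at hv with h1 <;> omega
  · rw [mem_cPlus] at h
    refine hrun _ ?_ ?_
    · split_ifs at hv with h1 <;> split_ifs at hv' with h2 <;> omega
    · split_ifs at hv with h1 <;> split_ifs at hv' with h2 <;> omega

/-- **The run-doubling walk.** A property of assignments that is stable under `plusHalf` and under
rotations passes from an assignment to each of its constant assignments. -/
theorem walk (hS : 1 ≤ S) {P : (ZMod (2 * S + 1) → ι) → Prop}
    (hplus : ∀ σ, P σ → P (plusHalf σ))
    (hrot : ∀ σ (a : ZMod (2 * S + 1)), P σ → P (fun t => σ (t + a)))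
    {σ : ZMod (2 * S + 1) → ι} (hσ : P σ) (t₀ : ZMod (2 * S + 1)) : P (fun _ => σ t₀) := by
  suffices key : ∀ (fuel ℓ : ℕ) (τ : ZMod (2 * S + 1) → ι) (k : ι), P τ → 1 ≤ ℓ →
      2 * S + 1 ≤ ℓ + fuel → (∀ t : ZMod (2 * S + 1), t.val ≠ 0 → t.val ≤ ℓ → τ t = k) →
      P (fun _ => k) by
    refine key (2 * S + 1) 1 (fun t => σ (t + (t₀ - 1))) (σ t₀) (hrot σ _ hσ) le_rfl (by omega) ?_
    intro t ht0 ht1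
    have h1 : t = 1 := by
      rw [← ZMod.natCast_zmod_val t, show t.val = 1 by omega, Nat.cast_one]
    simp [h1]
  intro fuel
  induction fuel with
  | zero =>
      intro ℓ τ k hτ _ hN hrun
      rw [← plusHalf_eq_const_of_run hS hrun (by omega)]
      exact hplus τ hτ
  | succ n ih =>
      intro ℓ τ k hτ hℓ hN hrun
      by_cases hℓS : S + 1 ≤ ℓ
      · rw [← plusHalf_eq_const_of_run hS hrun hℓS]
        exact hplus τ hτ
      · refine ih (2 * ℓ) (fun t => plusHalf τ (t + -((ℓ : ℕ) : ZMod (2 * S + 1)))) k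
          (hrot _ _ (hplus τ hτ)) (by omega) (by omega) ?_
        intro t ht0 ht
        show plusHalf τ (t + -((ℓ : ℕ) : ZMod (2 * S + 1))) = k
        rw [← sub_eq_add_neg]
        exact plusHalf_sub_of_run hS hrun hℓ (by omega) t ht0 ht

/-- The weight identity behind the Schwarz step: `∏ f ∘ σ⁺ · ∏ f ∘ σ⁻ = (∏ f ∘ σ)²`. -/
theorem prod_plusHalf_mul_prod_minusHalf (hS : 1 ≤ S) (f : ι → ℝ) (σ : ZMod (2 * S + 1) → ι) :
    (∏ t, f (plusHalf σ t)) * (∏ t, f (minusHalf σ t)) = (∏ t, f (σ t)) ^ 2 := by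
  have hrefl : ∏ t, f (σ (1 - t)) = ∏ t, f (σ t) :=
    Fintype.prod_equiv (Equiv.subLeft (1 : ZMod (2 * S + 1))) _ _ (fun _ => rfl)
  rw [← Finset.prod_mul_distrib, sq]
  nth_rewrite 2 [← hrefl]
  rw [← Finset.prod_mul_distrib]
  refine Finset.prod_congr rfl fun t _ => ?_
  by_cases hm : t ∈ cMinus S
  · simp [plusHalf, minusHalf, hm, cPlus_of_cMinus hm]
  · by_cases hp : t ∈ cPlus S
    · simp [plusHalf, minusHalf, hm, hp, one_sub_eq_self hS hp hm]
    · simp [plusHalf, minusHalf, hm, hp, mul_comm]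

/-- `plusHalf` commutes with relabelling. -/
theorem plusHalf_comp {ι' : Type*} (σ : ι → ι') (ρ : ZMod (2 * S + 1) → ι) :
    plusHalf (σ ∘ ρ) = σ ∘ plusHalf ρ := by
  funext t; simp only [Function.comp_apply, plusHalf]; split_ifs <;> rfl

/-- `minusHalf` commutes with relabelling. -/
theorem minusHalf_comp {ι' : Type*} (σ : ι → ι') (ρ : ZMod (2 * S + 1) → ι) :
    minusHalf (σ ∘ ρ) = σ ∘ minusHalf ρ := by
  funext t; simp only [Function.comp_apply, minusHalf]; split_ifs <;> rfl

/-- **Chessboard estimate on the odd cycle** (Fröhlich–Israel–Lieb–Simon maximisation argument).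
A non-negative, rotation-invariant functional of assignments `ℤ/(2S+1) → ι` obeying the reflection
Schwarz inequality `Φ(σ)² ≤ Φ(σ⁺) Φ(σ⁻)` satisfies `Φ(σ)^{2S+1} ≤ ∏_t Φ(const (σ t))`. -/
theorem chessboard (hS : 1 ≤ S) (Φ : (ZMod (2 * S + 1) → ι) → ℝ) (h0 : ∀ σ, 0 ≤ Φ σ)
    (hrot : ∀ σ (a : ZMod (2 * S + 1)), Φ (fun t => σ (t + a)) = Φ σ)
    (hsch : ∀ σ, Φ σ ^ 2 ≤ Φ (plusHalf σ) * Φ (minusHalf σ)) (σ : ZMod (2 * S + 1) → ι) :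
    Φ σ ^ (2 * S + 1) ≤ ∏ t, Φ (fun _ => σ t) := by
  classical
  rcases (h0 σ).eq_or_lt with hzero | hpos
  · rw [← hzero, zero_pow (by omega)]
    exact Finset.prod_nonneg fun t _ => h0 _
  -- positivity propagates to the constant assignments
  have hpos_plus : ∀ τ : ZMod (2 * S + 1) → ι, 0 < Φ τ → 0 < Φ (plusHalf τ) := by
    intro τ hτ
    have key := (pow_pos hτ 2).trans_le (hsch τ)
    rcases (h0 (plusHalf τ)).eq_or_lt with h | h
    · rw [← h, zero_mul] at key; exact absurd key (lt_irrefl 0)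
    · exact h
  have hw : ∀ t, 0 < Φ (fun _ => σ t) := fun t =>
    walk hS (P := fun τ => 0 < Φ τ) hpos_plus (fun τ a hτ => by rwa [hrot]) hpos t
  -- the ratio over re-indexings
  set w : ZMod (2 * S + 1) → ℝ := fun t => Φ (fun _ => σ t) with hw_def
  set R : (ZMod (2 * S + 1) → ZMod (2 * S + 1)) → ℝ :=
    fun ρ => Φ (σ ∘ ρ) ^ (2 * S + 1) / ∏ t, w (ρ t) with hR_def
  have hden : ∀ ρ : ZMod (2 * S + 1) → ZMod (2 * S + 1), 0 < ∏ t, w (ρ t) :=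
    fun ρ => Finset.prod_pos fun t _ => hw (ρ t)
  have hR0 : ∀ ρ, 0 ≤ R ρ := fun ρ => div_nonneg (pow_nonneg (h0 _) _) (hden ρ).le
  obtain ⟨ρm, -, hmax⟩ := Finset.exists_max_image Finset.univ R Finset.univ_nonempty
  set M := R ρm with hM
  -- Schwarz for the ratio
  have hRsch : ∀ ρ, R ρ ^ 2 ≤ R (plusHalf ρ) * R (minusHalf ρ) := by
    intro ρ
    have h1 : (Φ (σ ∘ ρ) ^ (2 * S + 1)) ^ 2 ≤
        Φ (σ ∘ plusHalf ρ) ^ (2 * S + 1) * Φ (σ ∘ minusHalf ρ) ^ (2 * S + 1) := by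
      rw [← mul_pow, pow_right_comm, ← plusHalf_comp, ← minusHalf_comp]
      exact pow_le_pow_left₀ (sq_nonneg _) (hsch _) _
    have h2 := prod_plusHalf_mul_prod_minusHalf hS w ρ
    simp only [hR_def, div_pow, div_mul_div_comm, h2]
    exact div_le_div_of_nonneg_right h1 (sq_nonneg _)
  have hplusM : ∀ ρ, M ≤ R ρ → M ≤ R (plusHalf ρ) := by
    intro ρ hρ
    rcases le_or_gt M 0 with hM0 | hM0
    · exact hM0.trans (hR0 _)
    · have : M * M ≤ R (plusHalf ρ) * M :=
        calc M * M ≤ R ρ ^ 2 := by rw [sq]; exact mul_le_mul hρ hρ hM0.le (hR0 ρ)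
          _ ≤ R (plusHalf ρ) * R (minusHalf ρ) := hRsch ρ
          _ ≤ R (plusHalf ρ) * M :=
            mul_le_mul_of_nonneg_left (hmax _ (Finset.mem_univ _)) (hR0 _)
      exact le_of_mul_le_mul_right this hM0
  have hrotM : ∀ ρ (a : ZMod (2 * S + 1)), M ≤ R ρ → M ≤ R (fun t => ρ (t + a)) := by
    intro ρ a hρ
    have : R (fun t => ρ (t + a)) = R ρ := by
      simp only [hR_def]
      rw [Fintype.prod_equiv (Equiv.addRight a) (fun t => w (ρ (t + a))) (fun t => w (ρ t))
        (fun _ => rfl)]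
      exact congrArg (fun x => x ^ (2 * S + 1) / ∏ t, w (ρ t)) (hrot (σ ∘ ρ) a)
    rwa [this]
  have key := walk hS (P := fun ρ : ZMod (2 * S + 1) → ZMod (2 * S + 1) => M ≤ R ρ)
    hplusM hrotM (le_refl M) 0
  have hR1 : R (fun _ => ρm 0) = 1 := by
    simp only [hR_def, Finset.prod_const, Finset.card_univ, ZMod.card]
    exact div_self (pow_ne_zero _ (hw _).ne')
  have hid : R id ≤ 1 := (hmax id (Finset.mem_univ _)).trans (key.trans_eq hR1)
  have hden' : 0 < ∏ t, w t := Finset.prod_pos fun t _ => hw t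
  have hid' : Φ σ ^ (2 * S + 1) / ∏ t, w t ≤ 1 := by simpa [hR_def] using hid
  rwa [div_le_one hden'] at hid'

end OddCycle

/-- **Chessboard estimate on the odd cycle `ℤ/(2S+1)`** (anchor of this support file; see
`OddCycle.chessboard`): a non-negative rotation-invariant functional obeying the reflection Schwarz
inequality `Φ(σ)² ≤ Φ(σ⁺) Φ(σ⁻)` satisfies `Φ(σ)^{2S+1} ≤ ∏_t Φ(const (σ t))`. -/
theorem oddCycle_chessboard : ∀ (S : ℕ), 1 ≤ S → ∀ (ι : Type) (Φ : (ZMod (2 * S + 1) → ι) → ℝ),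
    (∀ σ, 0 ≤ Φ σ) → (∀ σ (a : ZMod (2 * S + 1)), Φ (fun t => σ (t + a)) = Φ σ) →
    (∀ σ, Φ σ ^ 2 ≤ Φ (OddCycle.plusHalf σ) * Φ (OddCycle.minusHalf σ)) →
    ∀ σ : ZMod (2 * S + 1) → ι, Φ σ ^ (2 * S + 1) ≤ ∏ t, Φ (fun _ => σ t) :=
  fun _ hS _ Φ h0 hrot hsch σ => OddCycle.chessboard hS Φ h0 hrot hsch σ

end Summit.QuantumFields.QCD.Cruxes.WindowExtinction.ChessboardColdCells

end
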